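import Literature.AnabelianGeometry.EtaleTheta.Discharge.Sec2TowerRowsAtModelTateOfExtendsHgal
import Literature.AnabelianGeometry.EtaleTheta.Discharge.Sec2Cor218iAtModelTateNonInnerModFour
import HarnessLib

/-!
# [EtTh] §2 tower / rigidity rows AT THE TATE DATUM OF RECORD with the Cor. 2.18 (i) binder `h218i`
# REPLACED by abc-iut-L6-d6's reduction `⟸ hextΔ` ALONE, for `p ≡ 1 (mod 4)` / `χ₄ ≡ 1` — the (HGAL) binder
# DROPPED (proof-only capstone; FROZEN FACT-LIST rows F-0620 at every chain level, F-0649, F-0647, F-0625, F-0639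
# for the datum `etaleThetaDataχqInr p`)

S. Mochizuki, *The étale theta function and its Frobenioid-theoretic manifestations*, Publ. RIMS **45** (2009)
[EtTh], §2: Cor. 2.18 (i) p. 60, Cor. 2.18 (iv) pp. 61–62, Cor. 2.19 (ii) p. 64, Cor. 2.16 p. 53 (locators
`p.N` = PDF pages of the PRIMS text) [cite: MochizukiEtTh2009, Cor 2.19 (ii) p.64]. Cell `abc-iut`, block F,
seat abc-iut-f-148 (gen 7; L2 row «EtTh:Cor2.18(i)(ii) / Cor2.19(ii) K4-binder census at the Tate datum»,
abc-iut-L2-lead gen 7, L2 PACE @03:00Z 2026-08-27). PROOF-ONLY: no definition, no instance, no notation, no new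
named fact; every input consumed BY NAME (abc-iut-f-153's `…_of_rigidity` rows p453594/p454435/p456036/p457392 and
`Sec2TowerRowsAtModelTateOfExtendsHgal` p469677; abc-iut-L6-d6's `rigidData_cor218_i_modelχq_of_extends_of_levelChar_four`
/ `_of_mod_four_eq_one`, `Sec2Cor218iAtModelTateNonInnerModFour` p477049), nothing of another seat restated.

STATE OF RECORD BEFORE THIS FILE.  At the Tate instance `ThetaSetting.modelχq p 1 2` with the étale-theta datum of
record `etaleThetaDataχqInr p` (abc-iut-w5-d171), abc-iut-f-153's rows F-0647 (Cor. 2.18 (iv) odd bijectivity),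
F-0649 (Cor. 2.19 (ii)), F-0625 / F-0639 (Cor. 2.18 (iv) surjectivity) hold modulo {`h218i`, `h219iii`}
(`…_of_rigidity`), and — with `h218i` supplied by abc-iut-L6-d6's `rigidData_cor218_i_modelχq_of_extends_of_hgal`
(p468072) — modulo {`hextΔ`, `hgal`, `h219iii`} (`…_of_extends_of_hgal`, p469677).  abc-iut-L6-d6's later file
`Sec2Cor218iAtModelTateNonInnerModFour` (p477049) proves the same Cor. 2.18 (i) instance for EVERY étale-theta datum,
every `X̲̲`-choice, every level and the EMPTY cusp labelling FROM `hextΔ` ALONE whenever `χ₄ ≡ 1` on `G_{ℚ_p}` — in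
particular whenever `p ≡ 1 (mod 4)` (`rigidData_cor218_i_modelχq_of_extends_of_levelChar_four` /
`_of_mod_four_eq_one`): the (HGAL) binder «`γ` lies over an inner automorphism of `G_{ℚ_p}`» is not needed there.
abc-iut-w6-d050 composed that reduction for Cor. 2.19 (i) (`cor219_i_splittings_modelTate_inr_of_extends_of_mod_four_eq_one`,
p478893); for the TOWER rows (Cor. 2.18 (i) at the chain levels, Cor. 2.19 (ii), Cor. 2.18 (iv)) the one-term
composition was missing.  This file supplies it.

WHAT THIS FILE DOES (one-term compositions, `i := 1`, `L := L∅`; hypotheses `hp : p % 4 = 1` resp.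
`h4 : ∀ σ, χ₄(σ) = 1`):
* §1 `cor218_i_levels_emptyLabels_modelTate_inr_of_extends_of_levelChar_four` / `_of_mod_four_eq_one`,
  `cor218_i_modAll_emptyLabels_modelTate_inr_of_extends_of_mod_four_eq_one` — the binder `h218i` of the rows of
  record at EVERY chain level `τ.mod M` (and at the levels `τ.modAll M`) ⟸ `hextΔ` alone: F-0620 at the datum of record;
* §2 `cor219_ii_modelTate_inr_of_extends_of_levelChar_four` / `_of_mod_four_eq_one` — F-0649 [EtTh] Cor. 2.19 (ii)
  for the model tower of the datum of record ⟸ {`hextΔ`, `h219iii`};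
* §3 the Cor. 2.18 (iv) twins `cor218_iv_bijective_of_odd_modelTate_inr_of_extends_of_mod_four_eq_one` (F-0647),
  `rigidData_cor218_iv_surjective_modAll_modelTate_inr_of_extends_of_mod_four_eq_one` (F-0625, every `M ∈ ℕ≥1`),
  `thetaEnvData_cor218_iv_surjective_modAll_modelTate_inr_of_extends_of_mod_four_eq_one` (F-0639, idem), and the census
  conjunction `sec2_tower_rows_modelTate_inr_of_extends_of_mod_four_eq_one` — Cor. 2.16 ∧ Cor. 2.18 (iv)
  [reduction ∧ odd bijectivity] ∧ Cor. 2.19 (ii) at the datum of record ⟸ {`hextΔ`, `h219iii`}.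

RESIDUAL-OF-RECORD after this file, for `p ≡ 1 (mod 4)` (the case of every consumer carrying `4·l ∣ p − 1`, i.e.
`μ_{4l} ⊆ ℚ_p`): {`hextΔ`, `h219iii`} — both label-free.  `hextΔ` («every bi-continuous automorphism of `Π^tp_{X̲̲}`
EXTENDS to one of `Π^tp_X` stabilising `Δ^tp_X`», [EtTh] Prop. 2.4 (i) / [Mzk3] Thm. 2.4 shape) has its
Δ-STABILITY half at the `X̲̲`-level proved hypothesis-free at `modelχq` by abc-iut-w4-d044
(`deltaX_characteristic_setting_modelχq_holds`, p488629, at `EtaleLevels.setting`, whose `PiX` is `C.Huu`); its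
EXTENSION half is untouched.  `h219iii` (`ThetaEnvTower.Cor219_iii` at the datum) is CONDITIONAL-ON-HEARTS
(abc-iut-C-hgal-2 `cor219_iii_of_hearts_of_origin` p482618; hearts for ODD levels via abc-iut-L1-t6 p487040 / p488563,
EVEN levels = row «COR219III-M1b-EVEN (β)»).  For `p ≢ 1 (mod 4)` nothing here applies: the (HGAL)-free residual is
abc-iut-L6-d6's parity condition (`map_GtpYdd_eq_iff_levelHom_two_y_eq_zero`).

HONEST LABEL: `modelχq` is a SEMI-SYNTHETIC model of the typed §1 interface — binder-discharge / consistency evidence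
for OUR typed rows only; nothing of [EtTh] (refereed) is asserted; a FACT row is an assumption label, not an
endorsement; no side is taken on [IUTchIII] Cor. 3.12; typed ≠ proved.
-/

noncomputable section

namespace Literature.AnabelianGeometry.EtaleTheta.SettingModel

open Literature.AnabelianGeometry.SemiGraphs

variable (p : ℕ) [Fact p.Prime]
variable {l : ℕ} (C : (etaleThetaDataχqInr p).DoubleUnderline l) {Es : Set ℕ+}
  (τ : (ThetaSetting.modelχq p 1 2 even_two).CyclotomeTower l Es)

/-! ## §1. The binder `h218i` at the datum of record ⟸ `hextΔ` alone (`χ₄ ≡ 1` / `p ≡ 1 (mod 4)`) -/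

/-- **F-0620 [EtTh] Cor. 2.18 (i) at EVERY chain level of the model tower of the datum OF RECORD, at the empty cusp
labelling, FROM `hextΔ` ALONE, given `χ₄ ≡ 1` on `G_{ℚ_p}`** — abc-iut-L6-d6's
`rigidData_cor218_i_modelχq_of_extends_of_levelChar_four` at `i := 1`, `μ := τ.mod M`, `h15 :=` abc-iut-w5-d171's
`prop15iii_etaleThetaDataχqInr`.  This is the binder `h218i` of the `…_of_rigidity` rows of record (at `L := L∅`), with
the (HGAL) hypothesis of `cor218_i_levels_emptyLabels_modelTate_inr_of_extends_of_hgal` dropped.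
[cite: MochizukiEtTh2009, Cor 2.18 (i) p.60] -/
theorem cor218_i_levels_emptyLabels_modelTate_inr_of_extends_of_levelChar_four
    (h4 : ∀ σ : GQp p, ZHatLevel.levelChar 4 (chi p σ) = 1)
    (hext : ∀ γ : ↥C.Huu ≃ₜ* ↥C.Huu, ∃ Γ : PiTpχq p 1 2 ≃ₜ* PiTpχq p 1 2,
      (∀ h : C.Huu, Γ (h : PiTpχq p 1 2) = ((γ h : C.Huu) : PiTpχq p 1 2)) ∧
        (curveχq p 1 2).DeltaTemp.map Γ.toMulEquiv.toMonoidHom = (curveχq p 1 2).DeltaTemp)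
    (M : Es) :
    (C.rigidData (τ.mod M) (compat_modelχq p 1 2 even_two) (ThetaSetting.modelχq_sec2Hyps p 1 2 even_two)
      (prop15iii_etaleThetaDataχqInr p _) ⟨fun _ => ∅, fun _ => ∅, fun _ => rfl⟩).Cor218_i :=
  rigidData_cor218_i_modelχq_of_extends_of_levelChar_four p 1 h4 C (τ.mod M) _ _ _ hext

/-- **F-0620 [EtTh] Cor. 2.18 (i) at EVERY chain level of the model tower of the datum OF RECORD, at the empty cusp
labelling, FROM `hextΔ` ALONE, for `p ≡ 1 (mod 4)`** (abc-iut-L6-d6's `rigidData_cor218_i_modelχq_of_extends_of_mod_four_eq_one`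
at `i := 1`, `μ := τ.mod M`). [cite: MochizukiEtTh2009, Cor 2.18 (i) p.60] -/
theorem cor218_i_levels_emptyLabels_modelTate_inr_of_extends_of_mod_four_eq_one (hp : p % 4 = 1)
    (hext : ∀ γ : ↥C.Huu ≃ₜ* ↥C.Huu, ∃ Γ : PiTpχq p 1 2 ≃ₜ* PiTpχq p 1 2,
      (∀ h : C.Huu, Γ (h : PiTpχq p 1 2) = ((γ h : C.Huu) : PiTpχq p 1 2)) ∧
        (curveχq p 1 2).DeltaTemp.map Γ.toMulEquiv.toMonoidHom = (curveχq p 1 2).DeltaTemp)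
    (M : Es) :
    (C.rigidData (τ.mod M) (compat_modelχq p 1 2 even_two) (ThetaSetting.modelχq_sec2Hyps p 1 2 even_two)
      (prop15iii_etaleThetaDataχqInr p _) ⟨fun _ => ∅, fun _ => ∅, fun _ => rfl⟩).Cor218_i :=
  rigidData_cor218_i_modelχq_of_extends_of_mod_four_eq_one p 1 hp C (τ.mod M) _ _ _ hext

/-- The same at the levels `τ.modAll M`, `M ∈ ℕ≥1` (the level data used by the `modAll` surjectivity rows), for
`p ≡ 1 (mod 4)`. [cite: MochizukiEtTh2009, Cor 2.18 (i) p.60] -/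
theorem cor218_i_modAll_emptyLabels_modelTate_inr_of_extends_of_mod_four_eq_one (hp : p % 4 = 1)
    (hext : ∀ γ : ↥C.Huu ≃ₜ* ↥C.Huu, ∃ Γ : PiTpχq p 1 2 ≃ₜ* PiTpχq p 1 2,
      (∀ h : C.Huu, Γ (h : PiTpχq p 1 2) = ((γ h : C.Huu) : PiTpχq p 1 2)) ∧
        (curveχq p 1 2).DeltaTemp.map Γ.toMulEquiv.toMonoidHom = (curveχq p 1 2).DeltaTemp)
    (M : ℕ+) :
    (C.rigidData (τ.modAll M) (compat_modelχq p 1 2 even_two) (ThetaSetting.modelχq_sec2Hyps p 1 2 even_two)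
      (prop15iii_etaleThetaDataχqInr p _) ⟨fun _ => ∅, fun _ => ∅, fun _ => rfl⟩).Cor218_i :=
  rigidData_cor218_i_modelχq_of_extends_of_mod_four_eq_one p 1 hp C (τ.modAll M) _ _ _ hext

/-! ## §2. F-0649 Cor. 2.19 (ii) at the datum of record ⟸ {hextΔ, h219iii} -/

/-- **F-0649 [EtTh] Cor. 2.19 (ii) (Discrete Rigidity) for the model tower of the datum OF RECORD, modulo
{`hextΔ`, `ThetaEnvTower.Cor219_iii`}, given `χ₄ ≡ 1` on `G_{ℚ_p}`** (abc-iut-f-153's `cor219_ii_modelTate_inr_of_rigidity`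
at `L∅` with `h218i :=` §1). [cite: MochizukiEtTh2009, Cor 2.19 (ii) p.64] -/
theorem cor219_ii_modelTate_inr_of_extends_of_levelChar_four
    (h4 : ∀ σ : GQp p, ZHatLevel.levelChar 4 (chi p σ) = 1)
    (hext : ∀ γ : ↥C.Huu ≃ₜ* ↥C.Huu, ∃ Γ : PiTpχq p 1 2 ≃ₜ* PiTpχq p 1 2,
      (∀ h : C.Huu, Γ (h : PiTpχq p 1 2) = ((γ h : C.Huu) : PiTpχq p 1 2)) ∧
        (curveχq p 1 2).DeltaTemp.map Γ.toMulEquiv.toMonoidHom = (curveχq p 1 2).DeltaTemp)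
    (h219iii : (C.thetaEnvTower τ (compat_modelχq p 1 2 even_two)
      (ThetaSetting.modelχq_sec2Hyps p 1 2 even_two)).Cor219_iii) :
    (C.thetaEnvTower τ (compat_modelχq p 1 2 even_two)
      (ThetaSetting.modelχq_sec2Hyps p 1 2 even_two)).Cor219_ii :=
  cor219_ii_modelTate_inr_of_rigidity p C τ _
    (cor218_i_levels_emptyLabels_modelTate_inr_of_extends_of_levelChar_four p C τ h4 hext) h219iii

/-- **F-0649 [EtTh] Cor. 2.19 (ii) (Discrete Rigidity) for the model tower of the datum OF RECORD, modulo
{`hextΔ`, `ThetaEnvTower.Cor219_iii`}, for `p ≡ 1 (mod 4)`** — the (HGAL) binder of abc-iut-f-153's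
`cor219_ii_modelTate_inr_of_extends_of_hgal` dropped. [cite: MochizukiEtTh2009, Cor 2.19 (ii) p.64] -/
theorem cor219_ii_modelTate_inr_of_extends_of_mod_four_eq_one (hp : p % 4 = 1)
    (hext : ∀ γ : ↥C.Huu ≃ₜ* ↥C.Huu, ∃ Γ : PiTpχq p 1 2 ≃ₜ* PiTpχq p 1 2,
      (∀ h : C.Huu, Γ (h : PiTpχq p 1 2) = ((γ h : C.Huu) : PiTpχq p 1 2)) ∧
        (curveχq p 1 2).DeltaTemp.map Γ.toMulEquiv.toMonoidHom = (curveχq p 1 2).DeltaTemp)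
    (h219iii : (C.thetaEnvTower τ (compat_modelχq p 1 2 even_two)
      (ThetaSetting.modelχq_sec2Hyps p 1 2 even_two)).Cor219_iii) :
    (C.thetaEnvTower τ (compat_modelχq p 1 2 even_two)
      (ThetaSetting.modelχq_sec2Hyps p 1 2 even_two)).Cor219_ii :=
  cor219_ii_modelTate_inr_of_rigidity p C τ _
    (cor218_i_levels_emptyLabels_modelTate_inr_of_extends_of_mod_four_eq_one p C τ hp hext) h219iii

/-! ## §3. The Cor. 2.18 (iv) twins and the census conjunction ⟸ {hextΔ, h219iii} (`p ≡ 1 (mod 4)`) -/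

/-- **F-0647 [EtTh] Cor. 2.18 (iv) «[hence is a bijection if `N/M` is odd]» for the model tower of the datum OF
RECORD, modulo {`hextΔ`, `ThetaEnvTower.Cor219_iii`}, for `p ≡ 1 (mod 4)`** (abc-iut-f-153's
`cor218_iv_bijective_of_odd_modelTate_inr_of_rigidity` at `L∅` with `h218i :=` §1). [cite: MochizukiEtTh2009, Cor 2.18 (iv) p.62] -/
theorem cor218_iv_bijective_of_odd_modelTate_inr_of_extends_of_mod_four_eq_one (hp : p % 4 = 1)
    (hext : ∀ γ : ↥C.Huu ≃ₜ* ↥C.Huu, ∃ Γ : PiTpχq p 1 2 ≃ₜ* PiTpχq p 1 2,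
      (∀ h : C.Huu, Γ (h : PiTpχq p 1 2) = ((γ h : C.Huu) : PiTpχq p 1 2)) ∧
        (curveχq p 1 2).DeltaTemp.map Γ.toMulEquiv.toMonoidHom = (curveχq p 1 2).DeltaTemp)
    (h219iii : (C.thetaEnvTower τ (compat_modelχq p 1 2 even_two)
      (ThetaSetting.modelχq_sec2Hyps p 1 2 even_two)).Cor219_iii) :
    (C.thetaEnvTower τ (compat_modelχq p 1 2 even_two)
      (ThetaSetting.modelχq_sec2Hyps p 1 2 even_two)).Cor218_iv_bijective_of_odd :=
  cor218_iv_bijective_of_odd_modelTate_inr_of_rigidity p C τ _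
    (cor218_i_levels_emptyLabels_modelTate_inr_of_extends_of_mod_four_eq_one p C τ hp hext) h219iii

/-- **F-0625 [EtTh] Cor. 2.18 (iv), surjectivity, for the rigidity data of the datum OF RECORD at EVERY level
`M ∈ ℕ≥1` (empty cusp labelling), modulo {`hextΔ`, `ThetaEnvTower.Cor219_iii`}, for `p ≡ 1 (mod 4)`** (abc-iut-f-153's
`rigidData_cor218_iv_surjective_modAll_modelTate_inr_of_rigidity` with `h218i :=` §1). [cite: MochizukiEtTh2009, Cor 2.18 (iv) p.61] -/
theorem rigidData_cor218_iv_surjective_modAll_modelTate_inr_of_extends_of_mod_four_eq_one (hp : p % 4 = 1)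
    (M : ℕ+)
    (hext : ∀ γ : ↥C.Huu ≃ₜ* ↥C.Huu, ∃ Γ : PiTpχq p 1 2 ≃ₜ* PiTpχq p 1 2,
      (∀ h : C.Huu, Γ (h : PiTpχq p 1 2) = ((γ h : C.Huu) : PiTpχq p 1 2)) ∧
        (curveχq p 1 2).DeltaTemp.map Γ.toMulEquiv.toMonoidHom = (curveχq p 1 2).DeltaTemp)
    (h219iii : (C.thetaEnvTower τ (compat_modelχq p 1 2 even_two)
      (ThetaSetting.modelχq_sec2Hyps p 1 2 even_two)).Cor219_iii) :
    (C.rigidData (τ.modAll M) (compat_modelχq p 1 2 even_two) (ThetaSetting.modelχq_sec2Hyps p 1 2 even_two)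
      (prop15iii_etaleThetaDataχqInr p _) ⟨fun _ => ∅, fun _ => ∅, fun _ => rfl⟩).Cor218_iv_surjective :=
  rigidData_cor218_iv_surjective_modAll_modelTate_inr_of_rigidity p C τ M _
    (cor218_i_levels_emptyLabels_modelTate_inr_of_extends_of_mod_four_eq_one p C τ hp hext) h219iii

/-- **F-0639 the same in `ThetaEnvData` currency** (`Cor218_iv_surjective` of the level-`M` mono-theta environment of
the datum of record = the input `hsurj` of the [IUTchII] Prop. 1.5 model bridges of layer L6), modulo
{`hextΔ`, `ThetaEnvTower.Cor219_iii`}, for `p ≡ 1 (mod 4)`. [cite: MochizukiEtTh2009, Cor 2.18 (iv) p.61] -/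
theorem thetaEnvData_cor218_iv_surjective_modAll_modelTate_inr_of_extends_of_mod_four_eq_one (hp : p % 4 = 1)
    (M : ℕ+)
    (hext : ∀ γ : ↥C.Huu ≃ₜ* ↥C.Huu, ∃ Γ : PiTpχq p 1 2 ≃ₜ* PiTpχq p 1 2,
      (∀ h : C.Huu, Γ (h : PiTpχq p 1 2) = ((γ h : C.Huu) : PiTpχq p 1 2)) ∧
        (curveχq p 1 2).DeltaTemp.map Γ.toMulEquiv.toMonoidHom = (curveχq p 1 2).DeltaTemp)
    (h219iii : (C.thetaEnvTower τ (compat_modelχq p 1 2 even_two)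
      (ThetaSetting.modelχq_sec2Hyps p 1 2 even_two)).Cor219_iii) :
    (C.thetaEnvData (τ.modAll M) (compat_modelχq p 1 2 even_two)
      (ThetaSetting.modelχq_sec2Hyps p 1 2 even_two)).Cor218_iv_surjective :=
  thetaEnvData_cor218_iv_surjective_modAll_modelTate_inr_of_rigidity p C τ M _
    (cor218_i_levels_emptyLabels_modelTate_inr_of_extends_of_mod_four_eq_one p C τ hp hext) h219iii

/-- **THE §2 TOWER ROWS AT THE DATUM OF RECORD, modulo {`hextΔ`, `ThetaEnvTower.Cor219_iii`}, for `p ≡ 1 (mod 4)`**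
(Tate instance `modelχq p 1 2`, étale-theta datum `etaleThetaDataχqInr p`, every `X̲̲`-choice `C`, every cyclotome
tower `τ`; empty cusp labelling): Cor. 2.16 (F-0646) ∧ Cor. 2.18 (iv) reduction (F-0648) ∧ Cor. 2.18 (iv) odd
bijectivity (F-0647) ∧ Cor. 2.19 (ii) (F-0649) — abc-iut-f-153's `sec2_tower_rows_modelTate_inr_of_rigidity` with the
Cor. 2.18 (i) binder discharged by abc-iut-L6-d6's (HGAL)-free reduction. [cite: MochizukiEtTh2009, Cor 2.19 (ii) p.64] -/
theorem sec2_tower_rows_modelTate_inr_of_extends_of_mod_four_eq_one (hp : p % 4 = 1)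
    (hext : ∀ γ : ↥C.Huu ≃ₜ* ↥C.Huu, ∃ Γ : PiTpχq p 1 2 ≃ₜ* PiTpχq p 1 2,
      (∀ h : C.Huu, Γ (h : PiTpχq p 1 2) = ((γ h : C.Huu) : PiTpχq p 1 2)) ∧
        (curveχq p 1 2).DeltaTemp.map Γ.toMulEquiv.toMonoidHom = (curveχq p 1 2).DeltaTemp)
    (h219iii : (C.thetaEnvTower τ (compat_modelχq p 1 2 even_two)
      (ThetaSetting.modelχq_sec2Hyps p 1 2 even_two)).Cor219_iii) :
    (C.thetaEnvTower τ (compat_modelχq p 1 2 even_two) (ThetaSetting.modelχq_sec2Hyps p 1 2 even_two)).Cor216 ∧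
    (C.thetaEnvTower τ (compat_modelχq p 1 2 even_two)
      (ThetaSetting.modelχq_sec2Hyps p 1 2 even_two)).Cor218_iv_reduction ∧
    (C.thetaEnvTower τ (compat_modelχq p 1 2 even_two)
      (ThetaSetting.modelχq_sec2Hyps p 1 2 even_two)).Cor218_iv_bijective_of_odd ∧
    (C.thetaEnvTower τ (compat_modelχq p 1 2 even_two)
      (ThetaSetting.modelχq_sec2Hyps p 1 2 even_two)).Cor219_ii :=
  sec2_tower_rows_modelTate_inr_of_rigidity p C τ _
    (cor218_i_levels_emptyLabels_modelTate_inr_of_extends_of_mod_four_eq_one p C τ hp hext) h219iii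

end Literature.AnabelianGeometry.EtaleTheta.SettingModel

end
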